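import Summits.CriticalPhenomena.PercolationContinuityZ3.Theorems.PercNearOneGluingNoHeavyLowerTailSahiCTCLadderTwo
import Summits.CriticalPhenomena.PercolationContinuityZ3.Theorems.PercNearOneGluingNoHeavyLowerTailSahiCTCLadderTripleT
import HarnessLib

/-!
# `NoHeavyLowerTail` (crux stmt-CriticalPhenomena-4575), P3 lane: the level-3 ladder `(L_3)` reduced to its four doubled rows

Support file (seat `prim-l12-p3`, gen 26; `--supports stmt-CriticalPhenomena-4575`).  Memo g26 §3.  With `(L_2)` a tree theorem
(`…SahiCTCLadderTwo.coeff_ladder_two_nonneg`, gen 25) the all-level results of gen 26 give, for every pair of 3-live up-sets: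
`[m] L_3(𝒳,𝒵) ≥ 0` at every profile `m` that has an exponent `≥ 3` (`…LadderTripleT` + `(L_2)`, or vanishing), or no doubled point
(`…LadderSqfreeT`), or at least `5` doubled points (`…LadderRowTopT`): `coeff_ladder_three_nonneg_of_not_Drow`.
What remains of `(L_3)` are the profiles `m ≤ 2` with `1 ≤ #(dbl m) ≤ 4` (memo g26 §4).  Nothing is asserted about the crux.
-/

namespace Summit.CriticalPhenomena.PercolationContinuityZ3.Theorems.SahiCTCForms

open Finset MvPolynomial SahiCTCGenFun SahiCTCWeightedLYM

variable {α : Type*} [DecidableEq α] [Fintype α] {𝒳 𝒵 : Finset (Finset α)}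

omit [Fintype α] in
/-- A profile with values in `{0,1}` is the indicator of its support. [this work] -/
theorem eq_ind_support_of_le_one {m : α →₀ ℕ} (hm : ∀ i, m i ≤ 1) : m = ind m.support := by
  ext i
  rw [ind_apply]
  have := hm i
  by_cases h : i ∈ m.support
  · rw [if_pos h]; have h' := Finsupp.mem_support_iff.1 h; omega
  · rw [if_neg h]; exact Finsupp.notMem_support_iff.1 h

/-- **`(L_3)` outside the doubled rows `1 ≤ #dbl ≤ 4`**: for 3-live up-sets `𝒳, 𝒵` and a profile `m` with an exponent `≥ 3`, or with no
doubled point, or with at least five doubled points, the coefficient of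
`e_3·(Π·GF(𝒳∩𝒵) − GF(𝒳)GF(𝒵)) − Θ_2·e_{≥3}·GF((𝒳∩𝒵)_3)` at `m` is nonnegative. [this work] -/
theorem coeff_ladder_three_nonneg_of_not_Drow (h𝒳 : IsUpperSet (𝒳 : Set (Finset α))) (h𝒵 : IsUpperSet (𝒵 : Set (Finset α)))
    (hX3 : ∀ S ∈ 𝒳, 3 ≤ #S) (hZ3 : ∀ S ∈ 𝒵, 3 ≤ #S) (m : α →₀ ℕ)
    (hm : (∃ i, 3 ≤ m i) ∨ #(dbl m) = 0 ∨ 5 ≤ #(dbl m)) :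
    0 ≤ (ee 3 * (PiP * gf (𝒳 ∩ 𝒵) - gf 𝒳 * gf 𝒵) -
      gf (bySize (· ≤ 3 - 1) : Finset (Finset α)) * gf (bySize (3 ≤ ·) : Finset (Finset α)) *
        gf ((𝒳 ∩ 𝒵).filter fun S => #S = 3)).coeff m := by
  by_cases h4 : ∃ i, 4 ≤ m i
  · obtain ⟨i, hi⟩ := h4
    rw [coeff_ladder_eq_zero_of_four_le hi]
  have h3 : ∀ i, m i ≤ 3 := fun i => by by_contra h; exact h4 ⟨i, by omega⟩
  rcases hm with ⟨b, hb⟩ | h0 | h5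
  · -- a tripled point: (L_2) of the links
    have hb3 : m b = 3 := le_antisymm (h3 b) hb
    refine coeff_ladder_nonneg_of_triple (t := 3) (by norm_num) ?_ h𝒳 h𝒵 hX3 hZ3 hb3
    intro 𝒳' 𝒵' h1 h2 hX hZ m'
    exact coeff_ladder_two_nonneg h1 h2 (fun S hS => hX S hS) (fun S hS => hZ S hS) m'
  · -- no tripled point either (else the first case): decide on a tripled point first
    by_cases hT : ∃ b, m b = 3
    · obtain ⟨b, hb3⟩ := hT
      refine coeff_ladder_nonneg_of_triple (t := 3) (by norm_num) ?_ h𝒳 h𝒵 hX3 hZ3 hb3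
      intro 𝒳' 𝒵' h1 h2 hX hZ m'
      exact coeff_ladder_two_nonneg h1 h2 (fun S hS => hX S hS) (fun S hS => hZ S hS) m'
    · -- squarefree profile
      have h1 : ∀ i, m i ≤ 1 := fun i => by
        have hi3 := h3 i
        have hne3 : m i ≠ 3 := fun h => hT ⟨i, h⟩
        have hne2 : m i ≠ 2 := fun h => by
          have : i ∈ dbl m := mem_filter.2 ⟨Finsupp.mem_support_iff.2 (by omega), h⟩
          rw [card_eq_zero.1 h0] at this; simp at this
        omega
      rw [eq_ind_support_of_le_one h1]
      exact coeff_ladder_sqfree_nonneg (t := 3) h𝒳 h𝒵 (by norm_num) hX3 hZ3 _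
  · by_cases hT : ∃ b, m b = 3
    · obtain ⟨b, hb3⟩ := hT
      refine coeff_ladder_nonneg_of_triple (t := 3) (by norm_num) ?_ h𝒳 h𝒵 hX3 hZ3 hb3
      intro 𝒳' 𝒵' h1 h2 hX hZ m'
      exact coeff_ladder_two_nonneg h1 h2 (fun S hS => hX S hS) (fun S hS => hZ S hS) m'
    · have h2 : ∀ i, m i ≤ 2 := fun i => by
        have := h3 i; have hne : m i ≠ 3 := fun h => hT ⟨i, h⟩; omega
      rcases Nat.lt_or_ge 5 (#(dbl m)) with h6 | h5'
      · exact coeff_ladder_manyDoubled_nonneg h𝒳 h𝒵 (t := 3) (by norm_num) h2 (by omega)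
      · exact coeff_ladder_topRow_nonneg h𝒳 h𝒵 (t := 3) (by norm_num) hX3 hZ3 h2 (by omega)

end Summit.CriticalPhenomena.PercolationContinuityZ3.Theorems.SahiCTCForms
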